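import Summits.BirchSwinnertonDyer.Rank1Residual.F1Sign2.RealComponentAtTwo
import HarnessLib

/-!
# Cell `bsd-f1-sign2` — analytic / GZ lens (seat `-an`, g6): AN-21 «THE Ш[2] LEG» and the EGG-LOCUS LAW as ONE `iff`

STATEMENTS + PROVED bookkeeping (two support predicates with bodies, TWO `@[conjecture]` candidates AN-21 and the egg-locus law = open
obligations, nothing asserted; four theorems PROVED in-file by pure logic over the landed legs; no named fact, no `sorry`).

TYPER FILING (seat `bsd-f1-sign2-ty` g3, D-an-19; CANDIDATES.md rows AN-21 / AN-LAW): bodies VERBATIM from the planner's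
`HOME/MEMO-an-data/g6/Sketch_v10.lean` 866462ff8930c4ed (-an g6 2026-08-27T22:56:23Z; imports only the landed `F1Sign2/RealComponentAtTwo.lean` +
HarnessLib; lean rc 0 / 0 warnings / 0 sorry vs tree per -an, `Sketch_v10_check.json` 46e0c230feb0e848); the only edit is this header. Filed as a sibling
importing `RealComponentAtTwo.lean` (the planner's second option) so that the file of the four one-sided legs stays as audited. REF1-AUDIT-v1 §37 (7b9035fbefb790fe,
2026-08-27T23:06:59Z; D-an-17 ANSWERED; evidence `HOME/REF1-data/b34/`: as-is rc 0 / 0 / 0, the 4 logic theorems kernel-checked): predicates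
`TwistedRealMeetsEggAtTwo` / `OnEggLocusAtTwo` CORRECT; **AN-21 `RealComponentTrivialityOfShaTwoAtTwo` SURVIVES conjecture-grade** — BC7 CLEAN (∀×5 H×12 ⊢ false,
P1–P3 ok); NOT vacuous: `¬ ShaTwoTrivial W` unfolds (G4, `simp`) to «∃ c ∈ `WeierstrassCurve.sha W`, 2c = 0 ∧ c ≠ 0» over the GENUINE tree Ш
(`Sha.lean` :411, local kernels at all places inside `discreteH1 Γ_ℚ (geomPoints W)`, no placeholder); inflation step `Ш(E/ℚ)[2] ↪ Ш(E/K)[2]` checked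
(`E(K)^{σ=−1} ≅ E^{(D)}(ℚ)` finite odd); conjectural exactly at GZ ⊗ BSD₂(E/K) (REF2 §20 concurs); **REF1 INDEPENDENT SPOT-CENSUS** (b30 engine, root-finder
fixed; `NMAX` 8000, `|c′| ≤ 12`, `|a′| ≤ 8`; residuals ≤ 1.2e−13) on 12 curves of the AN-21 list: decisive corner (`ε = +1` generator on egg, Tam ODD,
`Ш_an = 4`) 27262b1 0/98, 32291a1 0/94, 39077b1 0/98, 40581c1 0/134, 45979a1 0/142, 52396a1 0/114, 62246a1 0/70 ⇒ 7/7 `κ = 0`; SHA `ε = −1` 40581i1 0/134,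
SHA Tam-even 43474b1 0/118; controls (`Ш_an = 1`) 27255e1 16/90, 39070c1 32/82, 40581j1 40/134 ⇒ 12/12 as the law predicts — `ShaTwoTrivial` is
LOAD-BEARING (first witnesses where `Ш[2]` alone flips `κ`); **the law `RealComponentEggLocusLawAtTwo` SURVIVES conjecture-grade** = AN-15R ∧ AN-15⁻ ∧ AN-17⁻ ∧
AN-21 (PROVED in-file), BC7 CLEAN (∀×2 H×7 ⊢ iff); `Dt` quantified inside ⇒ `κ` datum-independent (G1) is a consequence, intended. «-ty D-an-19: OK to
file Sketch_v10 verbatim (predicates, AN-21 + Law `@[conjecture]`, 4 logic theorems; per-conjunct placement per REF2 §20; cite REF1 §37 spot-census)» —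
done here. REF2-PLACEMENT v16 §20 (188a897895e6ace0, 2026-08-27T22:58:17Z; D-an-18 ANSWERED): AN-21 and the iff law are NOT IN PRINT in the
real-component (axis / `κ_E`) form — neither leg nor the iff; printed shadows: (1) the index–Ш relation at `2` as a CONJECTURE, Gross–Zagier 1986 V
(2.2)–(2.3) = Gross 1991 Conj. 1.2 (2) [held, p0213 L16–21] — the chain is conjecture-grade exactly at «`Ш(E/K)[2] ≠ 0 ⇒ 2 ∣ I_K`» (BSD₂(E/K) ⊗ GZ);
(2) nearest neighbour = a CONDITIONAL EQUIVALENCE with the same three objects, Kriz–Li 2019 (Forum Math. Sigma 7, e15 = arXiv:1606.03172) §4: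
`E(ℚ)[2] = 0`, `K` Heegner with `2` split, (★), `c₂` odd ⇒ Lemma 4.1 «`[E(K) : ℤP]/c_E` is a 2-adic unit» and Cor. 4.2 «BSD(2) for `E/K` ⟺ all `c_ℓ(E)`
odd ∧ `Ш(E/K)[2] = 0`» [p0016 L5–43], transported to twists `E^{(d)}`, `d ∈ 𝒩` by Thm 1.12 — the egg-locus law is the at-`∞` / axis AVATAR of Cor. 4.2
(«`P` 2-indivisible» ⟷ `κ_E = 1` by the AN-19 axis law + the egg clause carrying `ε`; `Ш(E/K)[2] ⟷ Ш(E/ℚ)[2]` by injective restriction; `c_ℓ` odd verbatim);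
what nobody proves in print is the Kolyvagin step at `2` («`y_K ∉ 2E(K) + E(K)_tors ⇒ Ш(E/K)[2] = 0`»: Gross 1991 Prop. 2.1 is for odd `p` [p0214 L9],
`2` is in Kolyvagin's exceptional set; Kriz–Li ASSUME BSD(2) for the base [p0016 L47]) nor the index converse without BSD₂ — so AN-21 and AN-17⁻ are
conjecture-grade for cause; other 2-divisibility theorems are CM/congruent-number (Tian 2012/2014, TYZ 2017, CLTZ 2015) or odd-part only (GJPST 2009
Alg. 3.20); per-conjunct placement (REF2's suggestion, carried in the law's docstring below): AN-15R / AN-15⁻ — Ogg 1983 / Snowden 2011 (v16 §5); AN-17⁻ —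
Jetchev 2008 Conj. 1.3 (v16 §12); AN-21 — GZ V (2.3) / Kriz–Li Cor. 4.2 (v16 §20); beyond-print theorem: no; refuted in print: nothing.
PARTITION: none moved; beyond-print theorem: no. bears_on: `stmt-BirchSwinnertonDyer-19099` (line `egg-kolyvagin-two`).

Planner's summary (verbatim). New in v10 (g6), on top of the landed `F1Sign2/RealComponentAtTwo.lean` (AN-15⁻, AN-15R, AN-17⁻):

* `TwistedRealMeetsEggAtTwo W Dt` — the egg indicator `κ_E(Dt) = 1` as a Prop: SOME point of the Fricke-twisted
  real locus `X₀(N)^{(c∘w_N)}(ℝ)` maps to the egg of `E(ℝ)` under `Dt.φ`;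
* `OnEggLocusAtTwo W` — the egg locus `E(ℚ) meets the egg ∧ Ш(E/ℚ)[2] = 0 ∧ ∏ c_ℓ odd`;
* **AN-21 `RealComponentTrivialityOfShaTwoAtTwo`** — the third one-sided leg: `Ш(E/ℚ)[2] ≠ 0 ⇒ κ_E = 0`
  (the corner no census had touched before g6: 0 of the 461 g5 curves; AN-21's own census = Cremona's rank-one
  optimal curves with `Ш_an ≥ 4`, odd torsion, `Δ > 0`, `N < 5·10⁵`: 978 curves + 978 `N`-matched `Ш_an = 1` controls);
* **`RealComponentEggLocusLawAtTwo`** — the law of record `κ_E(Dt) = 1 ⟺ E on the egg locus` (rank one, `Δ > 0`,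
  `E(ℚ)[2] = 0`, odd constant), and the KERNEL-CHECKED decomposition
  `RealComponentEggLocusLawAtTwo ↔ AN-15R ∧ AN-15⁻ ∧ AN-17⁻ ∧ AN-21` (pure logic): the law is exactly the
  conjunction of the surjectivity leg and the three triviality legs, so each census (AN-16: 206/206; T15.2 + AN-16:
  54/54; AN-17: 89/89; AN-21: this gen) tests one named conjunct, and a refutation of any conjunct refutes the law.
* `realComponentTrivialityOffEggLocusAtTwo_iff` — REF1/REF2's «visibility corollary» shape
  (`¬ egg locus ⇒ κ_E = 0`) is equivalent to the conjunction of the three triviality legs.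

Mechanism (why AN-21 should hold, conjecture-grade, same as AN-17⁻): for admissible Heegner `K`, `res : Ш(E/ℚ)[2] → Ш(E/K)`
is injective (`H¹(Gal(K/ℚ), E(K))[2] = 0` because `E^{(d)}(ℚ)` is finite of odd order when `E(ℚ)[2] = 0` and
`r_an(E^{(d)}) = 0`), so `Ш(E/K)[2] ≠ 0`, so by Gross–Zagier V (2.2) ⊗ BSD₂(E/K) the Heegner index `I_K` is even, so
`y_K ∈ 2E(K) + E(K)_tors ⊂ E⁰(ℝ)` under both real embeddings, and every twisted-real class carries self-paired Heegner
points (axis law (L2) + Chebotarev), so no class maps to the egg. [cite: GrossZagier1986, V.(2.2)] [cite: Kramer1981, Thm 1]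
-/

namespace Summit.BirchSwinnertonDyer.Rank1Residual.F1Sign2

open Literature.NumberTheory.EllipticCurves Literature.NumberTheory.EllipticCurves.ModularForms
open UpperHalfPlane

/-- The EGG INDICATOR as a Prop: `κ_E(Dt) = 1` iff SOME point `τ` of the Fricke-twisted real locus of level
`N = conductor` maps under `Dt.φ` to an affine point of `E(ℂ)` with REAL coordinates lying on the egg. [folklore] -/
def TwistedRealMeetsEggAtTwo (W : WeierstrassCurve ℚ) [NeZero (W.conductorNorm ℤ)]
    (Dt : ModularParametrizationData W (W.conductorNorm ℤ)) : Prop :=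
  ∃ τ : ℍ, OnFrickeTwistedRealLocus (W.conductorNorm ℤ) τ ∧
    ∃ (x y : ℝ) (h : (W.baseChange ℂ).toAffine.Nonsingular (x : ℂ) (y : ℂ)),
      Dt.φ τ = .some (x : ℂ) (y : ℂ) h ∧ OnEggR W x

/-- The EGG LOCUS (rank-one reading of the cell's ± object at 2): `E(ℚ)` meets the egg, `Ш(E/ℚ)[2] = 0`,
and the Tamagawa product is odd. [folklore] -/
def OnEggLocusAtTwo (W : WeierstrassCurve ℚ) : Prop :=
  MeetsEgg W ∧ ShaTwoTrivial W ∧ ¬ 2 ∣ W.tamagawaProduct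

/-- **AN-21 (the `Ш[2]` leg, conjecture-grade).** For a rank-one `E/ℚ` with `Δ > 0`, `E(ℚ)[2] = 0` and
`Ш(E/ℚ)[2] ≠ 0`, NO point of the Fricke-twisted real locus maps to the egg (any sign `ε`, any Tamagawa parity):
`Ш(E/ℚ)[2] ↪ Ш(E/K)[2]` for admissible `K`, so the Heegner index is even (GZ V (2.2) ⊗ BSD₂ over `K`), so every
self-paired Heegner point lies in `2E(K) + E(K)_tors ⊂ E⁰(ℝ)`, and every twisted-real class carries such points.
Census AN-21 (g6): Cremona rank-one optimal `Ш_an ≥ 4` curves vs `N`-matched `Ш_an = 1` controls (tables in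
`HOME/MEMO-an-data/g6/`). REF1-AUDIT §37: SURVIVES conjecture-grade, NOT vacuous (`¬ ShaTwoTrivial W` is over the genuine tree Ш); REF1's
independent spot-census on 12 curves of the AN-21 list: decisive corner (`ε = +1`, generator on the egg, Tam odd, `Ш_an = 4`) 7/7 `κ = 0`
(27262b1, 32291a1, 39077b1, 40581c1, 45979a1, 52396a1, 62246a1), SHA `ε = −1` / Tam-even 2/2 `κ = 0`, `Ш_an = 1` controls 3/3 `κ = 1` —
`ShaTwoTrivial` is load-bearing. REF2 v16 §20: not in print in this form; printed shadow GZ V (2.3) / Gross 1991 Conj. 1.2 (2); nearest Kriz–Li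
2019 Cor. 4.2. [conjecture] [cite: GrossZagier1986, V.(2.2)] [cite: Kramer1981, Thm 1] [cite: KrizLi2019, Cor. 4.2] -/
@[conjecture] def RealComponentTrivialityOfShaTwoAtTwo : Prop :=
  ∀ (W : WeierstrassCurve ℚ) [W.IsElliptic] [W.IsGloballyMinimal] [NeZero (W.conductorNorm ℤ)],
    0 < W.Δ → NoRationalTwoTorsion W → W.analyticRank = 1 → ¬ ShaTwoTrivial W →
    ∀ (Dt : ModularParametrizationData W (W.conductorNorm ℤ)), ¬ (2 : ℤ) ∣ Dt.c →
      ∀ τ : ℍ, OnFrickeTwistedRealLocus (W.conductorNorm ℤ) τ →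
        ∀ (x y : ℝ) (h : (W.baseChange ℂ).toAffine.Nonsingular (x : ℂ) (y : ℂ)),
          Dt.φ τ = .some (x : ℂ) (y : ℂ) h → ¬ OnEggR W x

/-- **THE EGG-LOCUS LAW (rank one; the lens's conjecture of record, conjecture-grade).** For `E/ℚ` with `Δ > 0`,
`E(ℚ)[2] = 0`, analytic rank one and a modular parametrisation of level `N` with odd constant:
`κ_E = 1 ⟺ E lies on the egg locus`, i.e. the component map `π₀(X₀(N)^{(c∘w_N)}(ℝ)) → π₀(E(ℝ))` hits the egg
iff `E(ℚ)` meets the egg, `Ш(E/ℚ)[2] = 0` and `∏ c_ℓ` is odd — equivalently `κ_E ≡ [E(K) : ℤ y_K] (mod 2)` for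
admissible `K`. Per-conjunct placement (REF2-PLACEMENT v16, for the decomposition `realComponentEggLocusLawAtTwo_iff` below): AN-15R /
AN-15⁻ — real components of the twisted locus, Ogg 1983 §3–4 / Snowden 2011 §6.8 (v16 §5: the statements NOT found in print); AN-17⁻ — Jetchev 2008
Conj. 1.3 / Thm. 1.4 (odd `p`) and Gross 1991 Conj. 1.2 (2) (v16 §12); AN-21 — Gross–Zagier 1986 V (2.3) / Kriz–Li 2019 Cor. 4.2 (v16 §20); the law as
a whole: NOT in print in this form, nearest = Kriz–Li 2019 §4 (conditional equivalence BSD(2)/K ⟺ `c_ℓ` odd ∧ `Ш(E/K)[2] = 0`). [conjecture]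
[cite: GrossZagier1986, V.(2.2)] [cite: Kramer1981, Thm 1] [cite: KrizLi2019, §4 (Lemma 4.1, Cor. 4.2), Thm 1.12] -/
@[conjecture] def RealComponentEggLocusLawAtTwo : Prop :=
  ∀ (W : WeierstrassCurve ℚ) [W.IsElliptic] [W.IsGloballyMinimal] [NeZero (W.conductorNorm ℤ)],
    0 < W.Δ → NoRationalTwoTorsion W → W.analyticRank = 1 →
    ∀ (Dt : ModularParametrizationData W (W.conductorNorm ℤ)), ¬ (2 : ℤ) ∣ Dt.c →
      (TwistedRealMeetsEggAtTwo W Dt ↔ OnEggLocusAtTwo W)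

/-- `κ_E(Dt) = 0` unfolded: no twisted-real point maps to the egg. [folklore] -/
theorem not_twistedRealMeetsEggAtTwo_iff (W : WeierstrassCurve ℚ) [NeZero (W.conductorNorm ℤ)]
    (Dt : ModularParametrizationData W (W.conductorNorm ℤ)) :
    ¬ TwistedRealMeetsEggAtTwo W Dt ↔
      ∀ τ : ℍ, OnFrickeTwistedRealLocus (W.conductorNorm ℤ) τ →
        ∀ (x y : ℝ) (h : (W.baseChange ℂ).toAffine.Nonsingular (x : ℂ) (y : ℂ)),
          Dt.φ τ = .some (x : ℂ) (y : ℂ) h → ¬ OnEggR W x := by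
  constructor
  · intro hn τ hτ x y h hφ hx
    exact hn ⟨τ, hτ, x, y, h, hφ, hx⟩
  · rintro hall ⟨τ, hτ, x, y, h, hφ, hx⟩
    exact hall τ hτ x y h hφ hx

/-- **KERNEL-CHECKED DECOMPOSITION: the egg-locus law is exactly AN-15R ∧ AN-15⁻ ∧ AN-17⁻ ∧ AN-21** (pure logic).
[folklore] -/
theorem realComponentEggLocusLawAtTwo_iff :
    RealComponentEggLocusLawAtTwo ↔
      (RealComponentSurjectivityOnEggLocusAtTwo ∧ RealComponentTrivialityAtTwo ∧
        RealComponentTrivialityOfEvenTamagawaAtTwo ∧ RealComponentTrivialityOfShaTwoAtTwo) := by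
  constructor
  · intro hL
    refine ⟨?_, ?_, ?_, ?_⟩
    · intro W _ _ _ hΔ h2 hSha hr hEgg hTam Dt hc
      exact (hL W hΔ h2 hr Dt hc).mpr ⟨hEgg, hSha, hTam⟩
    · intro W _ _ _ hΔ h2 hr hnEgg Dt hc τ hτ x y h hφ hx
      exact hnEgg ((hL W hΔ h2 hr Dt hc).mp ⟨τ, hτ, x, y, h, hφ, hx⟩).1
    · intro W _ _ _ hΔ h2 hr hTam Dt hc τ hτ x y h hφ hx
      exact ((hL W hΔ h2 hr Dt hc).mp ⟨τ, hτ, x, y, h, hφ, hx⟩).2.2 hTam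
    · intro W _ _ _ hΔ h2 hr hnSha Dt hc τ hτ x y h hφ hx
      exact hnSha ((hL W hΔ h2 hr Dt hc).mp ⟨τ, hτ, x, y, h, hφ, hx⟩).2.1
  · rintro ⟨hS, hT, hE, hSh⟩ W _ _ _ hΔ h2 hr Dt hc
    constructor
    · rintro ⟨τ, hτ, x, y, h, hφ, hx⟩
      refine ⟨?_, ?_, ?_⟩
      · by_contra hn
        exact hT W hΔ h2 hr hn Dt hc τ hτ x y h hφ hx
      · by_contra hn
        exact hSh W hΔ h2 hr hn Dt hc τ hτ x y h hφ hx
      · intro hdiv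
        exact hE W hΔ h2 hr hdiv Dt hc τ hτ x y h hφ hx
    · rintro ⟨hEgg, hSha, hTam⟩
      exact hS W hΔ h2 hSha hr hEgg hTam Dt hc

/-- **REF1/REF2's «visibility corollary» shape** — «`E` off the egg locus (`E(ℚ) ⊂ E⁰(ℝ)`, or `Ш(E/ℚ)[2] ≠ 0`,
or `∏ c_ℓ` even) ⇒ `κ_E = 0`» — is EQUIVALENT to the conjunction of the three triviality legs
AN-15⁻ ∧ AN-17⁻ ∧ AN-21 (pure logic). [folklore] -/
theorem realComponentTrivialityOffEggLocusAtTwo_iff :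
    (∀ (W : WeierstrassCurve ℚ) [W.IsElliptic] [W.IsGloballyMinimal] [NeZero (W.conductorNorm ℤ)],
        0 < W.Δ → NoRationalTwoTorsion W → W.analyticRank = 1 → ¬ OnEggLocusAtTwo W →
        ∀ (Dt : ModularParametrizationData W (W.conductorNorm ℤ)), ¬ (2 : ℤ) ∣ Dt.c →
          ¬ TwistedRealMeetsEggAtTwo W Dt) ↔
      (RealComponentTrivialityAtTwo ∧ RealComponentTrivialityOfEvenTamagawaAtTwo ∧
        RealComponentTrivialityOfShaTwoAtTwo) := by
  constructor
  · intro hV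
    refine ⟨?_, ?_, ?_⟩
    · intro W _ _ _ hΔ h2 hr hnEgg Dt hc τ hτ x y h hφ hx
      exact hV W hΔ h2 hr (fun hl => hnEgg hl.1) Dt hc ⟨τ, hτ, x, y, h, hφ, hx⟩
    · intro W _ _ _ hΔ h2 hr hTam Dt hc τ hτ x y h hφ hx
      exact hV W hΔ h2 hr (fun hl => hl.2.2 hTam) Dt hc ⟨τ, hτ, x, y, h, hφ, hx⟩
    · intro W _ _ _ hΔ h2 hr hnSha Dt hc τ hτ x y h hφ hx
      exact hV W hΔ h2 hr (fun hl => hnSha hl.2.1) Dt hc ⟨τ, hτ, x, y, h, hφ, hx⟩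
  · rintro ⟨hT, hE, hSh⟩ W _ _ _ hΔ h2 hr hoff Dt hc ⟨τ, hτ, x, y, h, hφ, hx⟩
    apply hoff
    refine ⟨?_, ?_, ?_⟩
    · by_contra hn
      exact hT W hΔ h2 hr hn Dt hc τ hτ x y h hφ hx
    · by_contra hn
      exact hSh W hΔ h2 hr hn Dt hc τ hτ x y h hφ hx
    · intro hdiv
      exact hE W hΔ h2 hr hdiv Dt hc τ hτ x y h hφ hx

/-- One direction worth naming: the law gives AN-21 (so AN-21's census is a falsifier OF THE LAW). [folklore] -/
theorem realComponentTrivialityOfShaTwoAtTwo_of_law (hL : RealComponentEggLocusLawAtTwo) :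
    RealComponentTrivialityOfShaTwoAtTwo :=
  (realComponentEggLocusLawAtTwo_iff.mp hL).2.2.2

end Summit.BirchSwinnertonDyer.Rank1Residual.F1Sign2
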